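/-
Copyright: the b2b-balaban cell (near-miss cell 7), T⁴-continuum fan-out; row NE7b ROUND-2 swarm, seat
t4-ne7b-formalise-leaf-02 (gen 3) — sub-row S6g′(a)-TOTAL, file 1∕2 (leaf-10 g2's specification, journal l.8499 (3);
leaf-04 g2's offer l.8981; claim l.9221).  Released under the licence of the surrounding project.
-/
import Summits.QuantumFields.BalabanUV.T4Continuum.Support.HistoryJoinsRoots

/-!
# Join sums, part counts and the DATING display of a shape tree (row S6g′(a)-TOTAL, file 1∕2)

Summits-side support leaf of the T⁴-continuum cell (rung (B)+1 on a FINITE torus only; NOT infinite volume, NOT the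
mass gap, NOT the Clay statement; NOT a proof of the spine estimate NE7b).  Row NE7b, route «COUNT», row S6g′
«MASS-BASED SIBLING COUNT» (R-OWNER-22-12 (2)); the tree-combinatorial half of the CLASS-LINEAR TOTAL of the zone mass
over the joins (file 2∕2 `HistoryZoneMassTotal`).  [folklore] structural recursion over the lineage's carrier `Gen ε`,
on top of leaf-05 g2's joins `HistoryJoins.croots` ∕ `crootsP` ∕ `clusterParts` ∕ `jparts` BY NAME (paths dropped:
every quantity summed here depends on the sub-structure only); nothing is quoted from print, nothing printed is
asserted, no `[cite:]` tag, no `Prop`-valued fact of Bałaban's minted.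

WHAT.  §1 node counts `nmerges` ∕ `nbirths` (`nmerges + 1 = nbirths`) and the dissolved-node count `cnodes st t X`.  §2 the
path-free views `cparts st t X` (step-`t` parts), `tparts st X` (parts of the top join), `jroots st p X` (joins below a
parent), **`joins st X := (croots st X).map Prod.snd`**, their recursion, `length_cparts = cnodes + 1`, the LIST identities
`sum_jroots_some` and **`sum_joins_merge`** (`Σ_{joins (merge Y Z e)} f = f (merge Y Z e) + Σ_{P ∈ tparts} Σ_{joins P} f`),
`length_joins_le` (`#joins ≤ nmerges`), the PART COUNT **`sum_length_tparts_eq`** (`Σ_{X ∈ joins G} #tparts X = nmerges G +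
#joins G ≤ 2·nmerges G`) and the bridges `sum_croots_eq_sum_joins` ∕ `sum_jparts_eq_sum_tparts`.  §3 the DATING display
**`Dated st s t G`** («`G` may hang under a cluster of step `t`; reached through a renewal (`s = true`) ⇒ its top join is
STRICTLY earlier»; births free; `Dated s t (renew Y …) := Dated true t Y`; `Dated s t (merge A B e) := st e ≤ t ∧ (s → st e
< t) ∧ Dated false (st e) A ∧ Dated false (st e) B`), `Dated.lax` ∕ `.mono` ∕ `.strict_succ`, `jroots_none_eq_some`.  §4
sanity.  WHY THE DISPLAY (details in file 2): under `ZoneSkeleton.Chrono` alone two nested joins may share a step through a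
renewal (renewals close clusters), and a decayed mass would then be charged twice at one decay level; histories read off a
process never do this.  `Dated` is decidable bookkeeping on OUR carrier, the binding's to discharge; nothing of print.

HONEST SCOPE.  Tree bookkeeping only; NE7b NOT proved; spine 0∕9.  HONEST DEPENDENCY (cell): continuum YM on T⁴ ⇐
BetaPertH ∧ nine spine estimates (0/9 proved); BetaPertH ⇐ (D1) ∧ (D4) ∧ CAP+tail; G-an2-4 gates asym, D1 and NE2/3/4.
This file changes none of it.
-/

open Literature.MathematicalPhysics.QuantumFieldTheory.Balaban1983to89
open T4PersistenceDictionary T4PartnerMultiplicity T4BranchingRecordsGas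
open Summit.QuantumFields.BalabanUV.T4Continuum.HistoryJoins

namespace Summit.QuantumFields.BalabanUV.T4Continuum.HistoryZoneMassJoins

variable {ε : Type*}

/-! ## §1 Node counts -/

section Counts

/-- the number of merge nodes [folklore] -/
def nmerges : Gen ε → ℕ
  | Gen.born _ _ => 0
  | Gen.renew Y _ _ => nmerges Y
  | Gen.merge Y Z _ => nmerges Y + nmerges Z + 1

/-- the number of births (leaves) [folklore] -/
def nbirths : Gen ε → ℕ
  | Gen.born _ _ => 1
  | Gen.renew Y _ _ => nbirths Y
  | Gen.merge Y Z _ => nbirths Y + nbirths Z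

/-- `nmerges` unfolds [folklore] -/
@[simp] theorem nmerges_born (b : ε) (j : ℕ) : nmerges (Gen.born b j) = 0 := rfl
/-- `nmerges` unfolds [folklore] -/
@[simp] theorem nmerges_renew (Y : Gen ε) (e : ε) (h : ℕ) : nmerges (Gen.renew Y e h) = nmerges Y := rfl
/-- `nmerges` unfolds [folklore] -/
@[simp] theorem nmerges_merge (Y Z : Gen ε) (e : ε) : nmerges (Gen.merge Y Z e) = nmerges Y + nmerges Z + 1 := rfl
/-- a binary tree has one more leaf than internal nodes [folklore] -/
theorem nmerges_add_one : ∀ G : Gen ε, nmerges G + 1 = nbirths G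
  | Gen.born _ _ => rfl
  | Gen.renew Y _ _ => nmerges_add_one Y
  | Gen.merge Y Z _ => by have hY := nmerges_add_one Y; have hZ := nmerges_add_one Z; simp only [nmerges, nbirths]; omega

variable (st : ε → ℕ)

/-- the number of step-`t` merge nodes DISSOLVED in the cluster at the top of `X` (`0` unless the top is a step-`t`
merger) [folklore] -/
def cnodes (t : ℕ) : Gen ε → ℕ
  | Gen.merge Y Z e => if st e = t then cnodes t Y + cnodes t Z + 1 else 0
  | _ => 0

/-- `cnodes` of a birth [folklore] -/
@[simp] theorem cnodes_born (t : ℕ) (b : ε) (j : ℕ) : cnodes st t (Gen.born b j) = 0 := rfl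

/-- `cnodes` of a renewal [folklore] -/
@[simp] theorem cnodes_renew (t : ℕ) (Y : Gen ε) (e : ε) (h : ℕ) : cnodes st t (Gen.renew Y e h) = 0 := rfl

/-- `cnodes` of a merger of the cluster's step [folklore] -/
theorem cnodes_merge_of_eq {t : ℕ} {Y Z : Gen ε} {e : ε} (he : st e = t) :
    cnodes st t (Gen.merge Y Z e) = cnodes st t Y + cnodes st t Z + 1 := by
  simp [cnodes, he]

/-- `cnodes` of a merger of another step [folklore] -/
theorem cnodes_merge_of_ne {t : ℕ} {Y Z : Gen ε} {e : ε} (he : st e ≠ t) : cnodes st t (Gen.merge Y Z e) = 0 := by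
  simp [cnodes, he]

end Counts

/-! ## §2 Path-free views of parts and joins; join sums as list identities -/

section Views

variable (st : ε → ℕ)

/-- the step-`t` parts at the top of `X`, as sub-structures [folklore] -/
def cparts (t : ℕ) (X : Gen ε) : List (Gen ε) := (clusterParts st t X).map Prod.snd

/-- the parts of the top join of `X`, as sub-structures [folklore] -/
def tparts (X : Gen ε) : List (Gen ε) := (jparts st X).map Prod.snd

/-- the joins below a parent, as sub-structures [folklore] -/
def jroots (p : Option ℕ) (X : Gen ε) : List (Gen ε) := (crootsP st p X).map Prod.snd

/-- **THE JOINS OF `X`**, as sub-structures (leaf-05 g2's `croots` with the paths dropped). [folklore] -/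
def joins (X : Gen ε) : List (Gen ε) := (croots st X).map Prod.snd

/-- dropping the paths forgets a shift of the paths [folklore] -/
theorem map_snd_shift {α : Type*} (l : List (List Bool × α)) (b : Bool) :
    (l.map fun q => (b :: q.1, q.2)).map Prod.snd = l.map Prod.snd := by
  rw [List.map_map]; rfl

/-- step-`t` parts of a birth [folklore] -/
@[simp] theorem cparts_born (t : ℕ) (b : ε) (j : ℕ) : cparts st t (Gen.born b j) = [Gen.born b j] := rfl
/-- step-`t` parts of a renewal [folklore] -/
@[simp] theorem cparts_renew (t : ℕ) (Y : Gen ε) (e : ε) (h : ℕ) :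
    cparts st t (Gen.renew Y e h) = [Gen.renew Y e h] := rfl
/-- step-`t` parts of a merger of step `t` [folklore] -/
theorem cparts_merge_of_eq {t : ℕ} {Y Z : Gen ε} {e : ε} (he : st e = t) :
    cparts st t (Gen.merge Y Z e) = cparts st t Y ++ cparts st t Z := by
  rw [cparts, clusterParts_merge_of_eq st he, List.map_append, map_snd_shift, map_snd_shift]; rfl
/-- step-`t` parts of a merger of another step [folklore] -/
theorem cparts_merge_of_ne {t : ℕ} {Y Z : Gen ε} {e : ε} (he : st e ≠ t) :
    cparts st t (Gen.merge Y Z e) = [Gen.merge Y Z e] := by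
  rw [cparts, clusterParts_merge_of_ne st he]; rfl
/-- the parts of the top join of a merger [folklore] -/
theorem tparts_merge (Y Z : Gen ε) (e : ε) : tparts st (Gen.merge Y Z e) = cparts st (st e) Y ++ cparts st (st e) Z := by
  rw [tparts, jparts_merge, List.map_append, map_snd_shift, map_snd_shift]; rfl
/-- `tparts` and `jparts` have the same length [folklore] -/
@[simp] theorem length_tparts (X : Gen ε) : (tparts st X).length = (jparts st X).length := List.length_map _
/-- `joins` and `croots` have the same length [folklore] -/
@[simp] theorem length_joins (X : Gen ε) : (joins st X).length = (croots st X).length := List.length_map _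

/-- the cluster has `cnodes + 1` parts [folklore] -/
theorem length_cparts (t : ℕ) : ∀ X : Gen ε, (cparts st t X).length = cnodes st t X + 1
  | Gen.born b j => rfl
  | Gen.renew Y e h => rfl
  | Gen.merge Y Z e => by
      by_cases he : st e = t
      · rw [cparts_merge_of_eq st he, List.length_append, length_cparts t Y, length_cparts t Z, cnodes_merge_of_eq st he]
        omega
      · rw [cparts_merge_of_ne st he, cnodes_merge_of_ne st he]; rfl

/-- the merge-node count splits over the cluster: parts' counts plus dissolved nodes [folklore] -/
theorem sum_cparts_nmerges (t : ℕ) : ∀ X : Gen ε, ((cparts st t X).map nmerges).sum + cnodes st t X = nmerges X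
  | Gen.born b j => rfl
  | Gen.renew Y e h => by simp
  | Gen.merge Y Z e => by
      by_cases he : st e = t
      · have hY := sum_cparts_nmerges t Y
        have hZ := sum_cparts_nmerges t Z
        rw [cparts_merge_of_eq st he, List.map_append, List.sum_append, cnodes_merge_of_eq st he, nmerges_merge]
        omega
      · rw [cparts_merge_of_ne st he, cnodes_merge_of_ne st he]; simp

/-- no joins below a birth [folklore] -/
@[simp] theorem jroots_born (p : Option ℕ) (b : ε) (j : ℕ) : jroots st p (Gen.born b j) = [] := by
  cases p <;> rfl
/-- below a renewal the parent step is forgotten [folklore] -/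
@[simp] theorem jroots_renew (p : Option ℕ) (Y : Gen ε) (e : ε) (h : ℕ) :
    jroots st p (Gen.renew Y e h) = jroots st none Y := by
  cases p <;> rfl
/-- the joins of `X` are the joins below no parent [folklore] -/
theorem joins_eq_jroots (X : Gen ε) : joins st X = jroots st none X := rfl
/-- joins of a birth [folklore] -/
@[simp] theorem joins_born (b : ε) (j : ℕ) : joins st (Gen.born b j) = [] := rfl
/-- joins of a renewal [folklore] -/
@[simp] theorem joins_renew (Y : Gen ε) (e : ε) (h : ℕ) : joins st (Gen.renew Y e h) = joins st Y := rfl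

/-- the joins below any parent, at a merger (definitional unfolding of leaf-05 g2's `crootsP`) [folklore] -/
theorem crootsP_merge (p : Option ℕ) (Y Z : Gen ε) (e : ε) :
    crootsP st p (Gen.merge Y Z e) = (if p = some (st e) then [] else [([], Gen.merge Y Z e)]) ++
      ((crootsP st (some (st e)) Y).map (fun q => (false :: q.1, q.2)) ++
        (crootsP st (some (st e)) Z).map (fun q => (true :: q.1, q.2))) := by
  cases p <;> rfl

/-- **THE JOINS OF A MERGER**: the top join, then the partners' joins below its step. [folklore] -/
theorem joins_merge (Y Z : Gen ε) (e : ε) :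
    joins st (Gen.merge Y Z e) = Gen.merge Y Z e :: (jroots st (some (st e)) Y ++ jroots st (some (st e)) Z) := by
  rw [joins, croots, crootsP_merge, if_neg (by simp), List.map_append, List.map_append, jroots, jroots, map_snd_shift,
    map_snd_shift]; rfl

/-- a merger of the parent's step contributes only its partners' joins [folklore] -/
theorem jroots_merge_of_eq {t : ℕ} {Y Z : Gen ε} {e : ε} (he : st e = t) :
    jroots st (some t) (Gen.merge Y Z e) = jroots st (some (st e)) Y ++ jroots st (some (st e)) Z := by
  rw [jroots, crootsP_merge, if_pos (by rw [he]), List.nil_append, List.map_append, jroots, jroots, map_snd_shift,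
    map_snd_shift]

/-- a merger of another step is itself a join: below the parent one sees all its joins [folklore] -/
theorem jroots_merge_of_ne {t : ℕ} {Y Z : Gen ε} {e : ε} (he : st e ≠ t) :
    jroots st (some t) (Gen.merge Y Z e) = joins st (Gen.merge Y Z e) := by
  rw [jroots, crootsP_merge, if_neg (fun h => he (Option.some.inj h).symm), joins_merge, List.map_append,
    List.map_append, jroots, jroots, map_snd_shift, map_snd_shift]; rfl

variable {M : Type*} [AddCommMonoid M] (f : Gen ε → M)

/-- **THE JOINS BELOW A STEP-`t` PARENT SUM OVER THE STEP-`t` PARTS' OWN JOIN SUMS** (list identity). [folklore] -/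
theorem sum_jroots_some (t : ℕ) : ∀ X : Gen ε,
    ((jroots st (some t) X).map f).sum = ((cparts st t X).map fun P => ((joins st P).map f).sum).sum
  | Gen.born b j => by simp
  | Gen.renew Y e h => by simp [joins_eq_jroots]
  | Gen.merge Y Z e => by
      by_cases he : st e = t
      · rw [jroots_merge_of_eq st he, cparts_merge_of_eq st he, List.map_append, List.sum_append, List.map_append,
          List.sum_append, he, sum_jroots_some t Y, sum_jroots_some t Z]
      · rw [jroots_merge_of_ne st he, cparts_merge_of_ne st he]; simp

/-- **THE JOIN SUM OF A MERGER**: its own value plus the join sums of the parts of its top join. [folklore] -/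
theorem sum_joins_merge (Y Z : Gen ε) (e : ε) :
    ((joins st (Gen.merge Y Z e)).map f).sum =
      f (Gen.merge Y Z e) + ((tparts st (Gen.merge Y Z e)).map fun P => ((joins st P).map f).sum).sum := by
  rw [joins_merge, List.map_cons, List.sum_cons, List.map_append, List.sum_append, tparts_merge, List.map_append,
    List.sum_append, sum_jroots_some st f (st e) Y, sum_jroots_some st f (st e) Z]

/-- sums written over leaf-05 g2's `croots` are sums over `joins` [folklore] -/
theorem sum_croots_eq_sum_joins (X : Gen ε) : ((croots st X).map fun q => f q.2).sum = ((joins st X).map f).sum := by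
  rw [joins, List.map_map]; rfl

/-- … and sums over `jparts` are sums over `tparts` [folklore] -/
theorem sum_jparts_eq_sum_tparts (X : Gen ε) : ((jparts st X).map fun q => f q.2).sum = ((tparts st X).map f).sum := by
  rw [tparts, List.map_map]; rfl

/-- the number of joins below a parent is at most the number of merge nodes [folklore] -/
theorem length_jroots_le : ∀ (p : Option ℕ) (X : Gen ε), (jroots st p X).length ≤ nmerges X
  | p, Gen.born b j => by simp
  | p, Gen.renew Y e h => by rw [jroots_renew]; exact length_jroots_le none Y
  | p, Gen.merge Y Z e => by
      have hY := length_jroots_le (some (st e)) Y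
      have hZ := length_jroots_le (some (st e)) Z
      by_cases hp : p = some (st e)
      · rw [hp, jroots_merge_of_eq st rfl, List.length_append, nmerges_merge]; omega
      · have hj : jroots st p (Gen.merge Y Z e) = joins st (Gen.merge Y Z e) := by
          cases p with
          | none => rfl
          | some t => exact jroots_merge_of_ne st (fun h => hp (by rw [h]))
        rw [hj, joins_merge, List.length_cons, List.length_append, nmerges_merge]; omega

/-- the number of joins is at most the number of merge nodes [folklore] -/
theorem length_joins_le (X : Gen ε) : (joins st X).length ≤ nmerges X := length_jroots_le st none X

/-- bookkeeping of the part count, below a step-`t` parent and parent-free, simultaneously [folklore] -/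
theorem sum_length_tparts_aux : ∀ X : Gen ε,
    (∀ t, ((jroots st (some t) X).map fun P => (tparts st P).length).sum + cnodes st t X =
        nmerges X + (jroots st (some t) X).length) ∧
      ((joins st X).map fun P => (tparts st P).length).sum = nmerges X + (joins st X).length
  | Gen.born b j => ⟨fun t => by simp, by simp⟩
  | Gen.renew Y e h => by
      have ih := (sum_length_tparts_aux Y).2
      exact ⟨fun t => by rw [jroots_renew, cnodes_renew, add_zero, ← joins_eq_jroots]; exact ih, ih⟩
  | Gen.merge Y Z e => by
      have hY := (sum_length_tparts_aux Y).1 (st e)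
      have hZ := (sum_length_tparts_aux Z).1 (st e)
      have hlen : (tparts st (Gen.merge Y Z e)).length = cnodes st (st e) Y + cnodes st (st e) Z + 2 := by
        rw [tparts_merge, List.length_append, length_cparts, length_cparts]; omega
      have hnone : ((joins st (Gen.merge Y Z e)).map fun P => (tparts st P).length).sum =
          nmerges (Gen.merge Y Z e) + (joins st (Gen.merge Y Z e)).length := by
        rw [joins_merge, List.map_cons, List.sum_cons, List.map_append, List.sum_append, List.length_cons,
          List.length_append, hlen, nmerges_merge]
        omega
      refine ⟨fun t => ?_, hnone⟩
      by_cases he : st e = t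
      · subst he
        rw [jroots_merge_of_eq st rfl, List.map_append, List.sum_append, List.length_append, cnodes_merge_of_eq st rfl,
          nmerges_merge]
        omega
      · rw [jroots_merge_of_ne st he, cnodes_merge_of_ne st he, add_zero]
        exact hnone

/-- **THE PART COUNT OVER ALL JOINS**: `Σ_{X ∈ joins G} #tparts X = nmerges G + #joins G` (every merge node is a dissolved
node of exactly one join; every join has one more part than dissolved nodes). [folklore] -/
theorem sum_length_tparts_eq (X : Gen ε) :
    ((joins st X).map fun P => (tparts st P).length).sum = nmerges X + (joins st X).length :=
  (sum_length_tparts_aux st X).2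

/-- hence at most `2·nmerges` parts in all [folklore] -/
theorem sum_length_tparts_le (X : Gen ε) : ((joins st X).map fun P => (tparts st P).length).sum ≤ 2 * nmerges X := by
  rw [sum_length_tparts_eq]
  have := length_joins_le st X
  omega

/-- every join is a merger [folklore] -/
theorem exists_eq_merge_of_mem_joins {X P : Gen ε} (hP : P ∈ joins st X) : ∃ A B e, P = Gen.merge A B e := by
  obtain ⟨q, hq, rfl⟩ := List.mem_map.1 hP
  exact exists_eq_merge_of_mem_crootsP st none X q hq

end Views

/-! ## §3 The dating display -/

section Dating

variable (st : ε → ℕ)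

/-- **THE DATING PREDICATE** `Dated st s t G`: «`G` may hang under a cluster of step `t`»; `s = true` records that `G` is
reached through a RENEWAL, and then its top join must be STRICTLY earlier than `t`; a merger's partners hang under the
merger's own step; births are free.  DISPLAYED by the total (file 2); an encoding-chronology fact of histories read off
a process (a renewal is never sandwiched between two mergers of the same step); a predicate with parameters, not a fact
of print. [folklore] -/
def Dated : Bool → ℕ → Gen ε → Prop
  | _, _, Gen.born _ _ => True
  | _, t, Gen.renew Y _ _ => Dated true t Y
  | s, t, Gen.merge A B e => st e ≤ t ∧ (s = true → st e < t) ∧ Dated false (st e) A ∧ Dated false (st e) B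

variable {st}

/-- unfolding at a birth [folklore] -/
@[simp] theorem dated_born (s : Bool) (t : ℕ) (b : ε) (j : ℕ) : Dated st s t (Gen.born b j) := by
  cases s <;> trivial

/-- unfolding at a renewal [folklore] -/
@[simp] theorem dated_renew (s : Bool) (t : ℕ) (Y : Gen ε) (e : ε) (h : ℕ) :
    Dated st s t (Gen.renew Y e h) ↔ Dated st true t Y := by
  cases s <;> exact Iff.rfl

/-- unfolding at a merger [folklore] -/
theorem dated_merge (s : Bool) (t : ℕ) (A B : Gen ε) (e : ε) :
    Dated st s t (Gen.merge A B e) ↔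
      st e ≤ t ∧ (s = true → st e < t) ∧ Dated st false (st e) A ∧ Dated st false (st e) B := by
  cases s <;> exact Iff.rfl

/-- strict implies lax [folklore] -/
theorem Dated.lax {t : ℕ} : ∀ {s : Bool} {G : Gen ε}, Dated st s t G → Dated st false t G
  | _, Gen.born _ _, _ => dated_born _ _ _ _
  | s, Gen.renew Y e h, hD => by rw [dated_renew] at hD ⊢; exact hD
  | s, Gen.merge A B e, hD => by
      rw [dated_merge] at hD ⊢
      exact ⟨hD.1, fun h => Bool.noConfusion h, hD.2.2.1, hD.2.2.2⟩

/-- monotone in the parent step [folklore] -/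
theorem Dated.mono {t t' : ℕ} (htt : t ≤ t') : ∀ {s : Bool} {G : Gen ε}, Dated st s t G → Dated st s t' G
  | _, Gen.born _ _, _ => dated_born _ _ _ _
  | s, Gen.renew Y e h, hD => by
      rw [dated_renew] at hD ⊢
      exact Dated.mono htt hD
  | s, Gen.merge A B e, hD => by
      rw [dated_merge] at hD ⊢
      exact ⟨hD.1.trans htt, fun h => lt_of_lt_of_le (hD.2.1 h) htt, hD.2.2.1, hD.2.2.2⟩

/-- a lax dating becomes strict one step later [folklore] -/
theorem Dated.strict_succ {t : ℕ} : ∀ {s : Bool} {G : Gen ε}, Dated st s t G → Dated st true (t + 1) G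
  | _, Gen.born _ _, _ => dated_born _ _ _ _
  | s, Gen.renew Y e h, hD => by
      rw [dated_renew] at hD ⊢
      exact Dated.strict_succ hD
  | s, Gen.merge A B e, hD => by
      rw [dated_merge] at hD ⊢
      exact ⟨Nat.le_succ_of_le hD.1, fun _ => Nat.lt_succ_of_le hD.1, hD.2.2.1, hD.2.2.2⟩

/-- **UNDER A STRICT DATING THE JOINS OF `Y` ARE THE JOINS BELOW A STEP-`t` PARENT** (the top join is not of step `t`).
[folklore] -/
theorem jroots_none_eq_some {t : ℕ} : ∀ {Y : Gen ε}, Dated st true t Y → jroots st none Y = jroots st (some t) Y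
  | Gen.born _ _, _ => by simp
  | Gen.renew Y e h, _ => by simp
  | Gen.merge A B e, hD => by
      rw [dated_merge] at hD
      rw [jroots_merge_of_ne st (hD.2.1 rfl).ne, joins_eq_jroots]

end Dating

/-! ## §4 Sanity (decided) -/

namespace Sanity

/-- steps read by the identity on `ℕ`-labels; `((a b)₃ c)₃` is ONE cluster of step 3 with two dissolved nodes, three
parts, one join; `nmerges = 2`, `nbirths = 3`; part count `3 = nmerges + #joins` -/
example :
    cnodes (fun n : ℕ => n) 3 (Gen.merge (Gen.merge (Gen.born 0 0) (Gen.born 1 1) 3) (Gen.born 2 2) 3) = 2 ∧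
    nmerges (Gen.merge (Gen.merge (Gen.born 0 0) (Gen.born 1 1) 3) (Gen.born 2 2) 3) = 2 ∧
    nbirths (Gen.merge (Gen.merge (Gen.born 0 0) (Gen.born 1 1) 3) (Gen.born 2 2) 3) = 3 ∧
    (joins (fun n : ℕ => n) (Gen.merge (Gen.merge (Gen.born 0 0) (Gen.born 1 1) 3) (Gen.born 2 2) 3)).length = 1 ∧
    ((joins (fun n : ℕ => n) (Gen.merge (Gen.merge (Gen.born 0 0) (Gen.born 1 1) 3) (Gen.born 2 2) 3)).map
        fun P => (tparts (fun n : ℕ => n) P).length).sum = 3 := by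
  decide

/-- the renewal sandwich `((a b)₃ ⟲) ⋈₃ c`: two joins sharing step 3; a lax dating under 3 FAILS (the renewed inner
merger would have to be strictly earlier than the outer step 3) — the configuration the display excludes; with the
outer merger at step 4 it holds -/
example :
    (joins (fun n : ℕ => n) (Gen.merge (Gen.renew (Gen.merge (Gen.born 0 0) (Gen.born 1 1) 3) 9 5) (Gen.born 2 2) 3)).length
        = 2 ∧
    ¬ Dated (fun n : ℕ => n) false 3
        (Gen.merge (Gen.renew (Gen.merge (Gen.born 0 0) (Gen.born 1 1) 3) 9 5) (Gen.born 2 2) 3) ∧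
      Dated (fun n : ℕ => n) false 4
        (Gen.merge (Gen.renew (Gen.merge (Gen.born 0 0) (Gen.born 1 1) 3) 9 5) (Gen.born 2 2) 4) := by
  refine ⟨by decide, ?_, ?_⟩
  · simp [Dated]
  · simp [Dated]

end Sanity

end Summit.QuantumFields.BalabanUV.T4Continuum.HistoryZoneMassJoins
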